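import Literature.NumberTheory.Automorphic.QuadraticOrdersConductors
import Mathlib.NumberTheory.LegendreSymbol.Basic
import Mathlib.NumberTheory.LegendreSymbol.ZModChar
import HarnessLib

/-!
# The root count `ρ_p(t, n)` as a Kronecker symbol: `ρ_p(t, n) = 1 + ((t² − 4n) ∕ p)`

Topic `NumberTheory/Automorphic`; theorems only (no named fact, no `sorry`). The Brandt-module ∕ Eichler–Selberg files
express the local embedding numbers and densities through `Brandt.rho q t n = #{x mod q : x² − tx + n ≡ 0 (mod q)}`
(`QuadraticOrdersConductors`). Classically this count is `1 + (D∕q)` with `D = t² − 4n` the discriminant and `(·∕q)`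
the Kronecker symbol — the number of roots of a quadratic modulo a prime (completing the square for odd `q`; a parity
check at `q = 2`, where `(D∕2)` is the Kronecker symbol `χ₈(D)` for `D ≡ 0, 1 (mod 4)`). This is the dictionary between
Eichler's `1 − {S∕p}`, Vignéras' `1 − (L∕p)` and the tree's `2 − ρ_p`:

* `rho_eq_one_add_legendreSym` — odd prime `q`: `ρ_q(t, n) = 1 + legendreSym q (t² − 4n)`;
* `rho_two_eq_one_add_χ₈'` — `q = 2`: `ρ₂(t, n) = 1 + χ₈(t² − 4n)`.

## References

* D. A. Cox, *Primes of the form x² + ny²*, 2nd ed. (2013), Lemma 1.7 ∕ (1.13) and §7.D Prop. 7.20 (splitting of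
  `p` in the order `O` ⟺ `(D∕p)`), [Cox2013].
* M.-F. Vignéras, *Arithmétique des algèbres de quaternions*, LNM 800 (1980), Ch. II §3 (`m_p = 1 − (L∕p)`),
  [VignerasLNM800].
-/

open Finset

namespace Literature.NumberTheory.Automorphic

namespace Brandt

/-! ### Odd primes: completing the square -/

section Odd

variable {q : ℕ} [hq : Fact q.Prime]

/-- For `q` odd, `x ↦ 2x − t` is a bijection of `ℤ/q` carrying the roots of `x² − tx + n` onto the square roots of
`t² − 4n` (`4(x² − tx + n) = (2x − t)² − (t² − 4n)`). [cite: Cox2013, Lemma 1.7 and §7.D Prop. 7.20] -/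
theorem card_roots_eq_card_sqrts (hq2 : q ≠ 2) (t n : ZMod q) :
    #{x : ZMod q | x ^ 2 - t * x + n = 0} = #{y : ZMod q | y ^ 2 = t ^ 2 - 4 * n} := by
  classical
  -- `2` is a unit of `ZMod q`
  have h2 : (2 : ZMod q) ≠ 0 := by
    intro h
    have h' : ((2 : ℕ) : ZMod q) = 0 := by exact_mod_cast h
    rw [ZMod.natCast_eq_zero_iff] at h'
    exact hq2 ((Nat.prime_dvd_prime_iff_eq hq.out Nat.prime_two).mp h')
  refine Finset.card_bij (fun x _ => 2 * x - t) (fun x hx => ?_) (fun x _ y _ hxy => ?_) (fun y hy => ?_)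
  · rw [Finset.mem_filter] at hx ⊢
    refine ⟨Finset.mem_univ _, ?_⟩
    linear_combination 4 * hx.2
  · have := sub_left_injective hxy
    exact mul_left_cancel₀ h2 this
  · refine ⟨(2 : ZMod q)⁻¹ * (y + t), ?_, ?_⟩
    · rw [Finset.mem_filter] at hy ⊢
      refine ⟨Finset.mem_univ _, ?_⟩
      have e : ((2 : ZMod q)⁻¹ * (y + t)) ^ 2 - t * ((2 : ZMod q)⁻¹ * (y + t)) + n =
          (2 : ZMod q)⁻¹ ^ 2 * (y ^ 2 - (t ^ 2 - 4 * n)) := by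
        have h4 : (2 : ZMod q)⁻¹ ^ 2 * 4 = 1 := by
          rw [show (4 : ZMod q) = 2 ^ 2 by norm_num, ← mul_pow, inv_mul_cancel₀ h2, one_pow]
        have h2' : (2 : ZMod q)⁻¹ * 2 = 1 := inv_mul_cancel₀ h2
        linear_combination ((2 : ZMod q)⁻¹ * t * (y + t)) * h2' - n * h4
      rw [e, hy.2, sub_self, mul_zero]
    · rw [← mul_assoc, mul_inv_cancel₀ h2, one_mul, add_sub_cancel_right]

/-- **`ρ_q(t, n) = 1 + ((t² − 4n)∕q)` for an odd prime `q`**: the number of roots of `x² − tx + n` modulo `q` is `0`,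
`1` or `2` according as the discriminant `t² − 4n` is a non-residue, divisible by `q`, or a non-zero residue.
[cite: Cox2013, Lemma 1.7 and §7.D Prop. 7.20] [cite: VignerasLNM800, Ch. II §3] -/
theorem rho_eq_one_add_legendreSym (hq2 : q ≠ 2) (t n : ℤ) :
    (rho q t n : ℤ) = 1 + legendreSym q (t ^ 2 - 4 * n) := by
  classical
  have hchar : ringChar (ZMod q) ≠ 2 := by rw [ZMod.ringChar_zmod_n]; exact hq2
  rw [rho_eq_card_zmod, card_roots_eq_card_sqrts hq2, legendreSym]
  have h := quadraticChar_card_sqrts hchar ((t : ZMod q) ^ 2 - 4 * (n : ZMod q))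
  have e : ({y : ZMod q | y ^ 2 = (t : ZMod q) ^ 2 - 4 * (n : ZMod q)} : Set (ZMod q)).toFinset =
      Finset.univ.filter (fun y : ZMod q => y ^ 2 = (t : ZMod q) ^ 2 - 4 * (n : ZMod q)) := by
    ext y; simp
  rw [e] at h
  push_cast
  rw [h]; ring

end Odd

/-! ### The prime `2`: the Kronecker symbol `χ₈` -/

/-- **`ρ₂(t, n) = 1 + χ₈(t² − 4n)`**: modulo `2`, `x² − tx + n` has one root if `t` is even (`(D∕2) = 0`, `D = t² − 4n`
even), two roots if `t` is odd and `n` even (`D ≡ 1 (mod 8)`, `χ₈(D) = 1`), none if `t, n` are odd (`D ≡ 5 (mod 8)`,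
`χ₈(D) = −1`) — brute force over `ℤ/8`. [cite: Cox2013, §7.D (the Kronecker symbol at 2)] -/
theorem rho_two_eq_one_add_χ₈' (t n : ℤ) :
    (rho 2 t n : ℤ) = 1 + ZMod.χ₈ (((t ^ 2 - 4 * n : ℤ)) : ZMod 8) := by
  rw [rho_eq_card_zmod,
    show ((t : ℤ) : ZMod 2) = ZMod.castHom (show 2 ∣ 8 by norm_num) (ZMod 2) ((t : ℤ) : ZMod 8) from
      (map_intCast _ t).symm,
    show ((n : ℤ) : ZMod 2) = ZMod.castHom (show 2 ∣ 8 by norm_num) (ZMod 2) ((n : ℤ) : ZMod 8) from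
      (map_intCast _ n).symm]
  push_cast
  generalize (t : ZMod 8) = a
  generalize (n : ZMod 8) = b
  revert a b
  decide

/-- **The local embedding number of a maximal order at an odd ramified prime is `1 − (D∕q)`**: for `B_f` maximal at `q`
(`fq` not a conductor), `2 − ρ_q(t_f, n_f) = 1 − ((t_f² − 4n_f)∕q)`. [cite: VignerasLNM800, Ch. II §3 («`m_p = 1 − (L∕p)`»)] -/
theorem two_sub_rho_eq_one_sub_legendreSym {q : ℕ} [Fact q.Prime] (hq2 : q ≠ 2) (t n : ℤ) :
    (2 : ℤ) - rho q t n = 1 - legendreSym q (t ^ 2 - 4 * n) := by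
  rw [rho_eq_one_add_legendreSym hq2]; ring

end Brandt

end Literature.NumberTheory.Automorphic
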